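import Literature.Algebra.Module.DivisiblePrimaryModulesDVR
import Literature.Algebra.Module.QuasicyclicModuleEndomorphismsDVR
import Literature.Algebra.Module.PIDModuleCancellation
import Mathlib.Algebra.Module.Torsion.Basic
import HarnessLib

/-!
# A `ϖ`-primary module whose bounded layers are `R/(ϖ^{e_k}) ⊕ F_k` with `F_k` uniformly bounded is
# `K/R ⊕ F` (the "and so `H¹_F(K, A) ≅ 𝒟 ⊕ M ⊕ M`" step of Howard 2004, Thm. 1.6.1, over Kaplansky §5)

Topic `Algebra/Module`; namespace `Literature.Algebra.Module`.  THEOREMS ONLY: no definition, no named fact, no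
instance, no `sorry`; net debt 0.  VOCABULARY (spelled out in every statement, as in
`QuasicyclicModulesDVR.lean` / `DivisiblePrimaryModulesDVR.lean`): `R` is a discrete valuation ring with
uniformizer `ϖ` (`Irreducible ϖ`), `K = FractionRing R`, "`K/R`" is `FractionRing R ⧸ (1 : Submodule R (FractionRing R))`
(= the tree's `Howard2004.FracModR R` by `abbrev`), a module `L` is `ϖ`-PRIMARY when every element is killed
by a power of `ϖ`, its LAYERS are the bounded submodules `L[ϖⁿ] = Submodule.torsionBy R L (ϖ ^ n)`, and a
TOWER is `x : ℕ → L` with `ϖ • x 0 = 0`, `x 0 ≠ 0`, `ϖ • x (n + 1) = x n`.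

## The statement and where it is used

B. Howard, *The Heegner point Kolyvagin system*, Compositio Math. 140 (2004), proof of Thm. 1.6.1 (arXiv:1202.6340
Thm. 2.6.1, p. 12 L40–46): "… and we conclude that `H¹_F(K, A)[𝔪^k] ≅ R/𝔪^k ⊕ M^{(k)} ⊕ M^{(k)}` with
`len_R(M^{(k)}) < k`, and so for some finite `R`-module `M ≅ M^{(k)}` there is an isomorphism
`H¹_F(K, A) ≅ 𝒟 ⊕ M ⊕ M`."  The step "and so" is pure module theory over the discrete valuation ring `R`
(`𝒟 = Φ/R`, `A` a `ϖ`-primary = `𝔪`-primary torsion module, the layers indexed by the levels `k ↦ e_k` of the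
`π`-adic tower): it is the theorem `nonempty_linearEquiv_fractionRingQuotient_prod_of_torsionBy_layers` below,
stated for an arbitrary `ϖ`-primary module `L` whose layers `L[ϖ^{e k}]` (for an unbounded `e : ℕ → ℕ`) are
`R`-isomorphic to `R/(ϖ^{e k}) × F k` with finitely generated `F k` killed by a FIXED power `ϖ ^ c` — then
`L ≃ₗ[R] K/R × F k₀` for every `k₀` with `c ≤ e k₀` (Howard: `F k = M^{(k)} × M^{(k)}`, `c = k − 1` at the fixed
level).  The consumer is the tree's typed conclusion of Thm. 1.6.1, `Howard2004.DVRSetting.Conclusion` (ii)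
(`Literature/NumberTheory/GaloisCohomology/Howard2004/DVRKolyvaginBound.lean`), whose reduction to the printed
levelwise inputs (`DVRKolyvaginBoundProofs.lean` §H/§I) still lacked exactly this colimit algebra.

## Proof (Kaplansky, *Infinite Abelian Groups*, §5 Theorems 2–4, composed; no new structure theory)

1. (§1) Arithmetic in `R/(ϖᴺ)`: an element killed by `ϖᵃ`, `a < N`, is a multiple of `ϖ`; `ϖᶜ · 1 ≠ 0` for `c < N`.
2. (§2) Reading TWO layers `e k < e k'` through the given isomorphisms, the submodule `ϖᶜ L` is `ϖ`-divisible,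
   hence divisible (`Purity.divisible_of_forall_exists_smul_eq`), and non-zero; so it contains a tower `x`
   (`exists_tower_mem_of_divisible`), whose span `S` is divisible (`divisible_span_range_tower`), hence a direct
   summand `L = S ⊕ N` (§5 Theorem 2, `exists_isCompl_of_divisible`), and `S ≅ K/R` (§5 Theorem 4,
   `nonempty_linearEquiv_fractionRing_quotient_of_tower`).
3. (§3) The layers of the span of a tower: `S ⊓ L[ϖⁿ⁺¹] = R ∙ xₙ ≅ R/(ϖⁿ⁺¹)`
   (`mem_span_singleton_tower_of_pow_smul_eq_zero` of `QuasicyclicModuleEndomorphismsDVR.lean`).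
4. (§4) Layers split along `L = S ⊕ N`: `L[ϖⁿ] ≅ (S ⊓ L[ϖⁿ]) × (N ⊓ L[ϖⁿ])`; with the hypothesis and
   CANCELLATION of the common finitely generated factor `R/(ϖ^{e k})` (Hungerford IV Cor. 6.13 / II §2 Ex. 11 (b),
   `nonempty_linearEquiv_of_prod_linearEquiv_prod`) every layer of `N` is `N ⊓ L[ϖ^{e k}] ≅ F k`, so `ϖᶜ N = 0`,
   `N = N ⊓ L[ϖ^{e k₀}] ≅ F k₀`, and `L ≅ S × N ≅ K/R × F k₀` (§5).
Also recorded: the EXHAUSTION form (§5, layers presented as injections `G k ↪ L` with range `L[ϖ^{e k}]`, the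
shape in which Howard's `H¹_F(K, T^{(k)}) ↪ H¹_F(K, A)` of Lemma 1.3.3 arrives) and the `𝔪`-power / `M × M`
currency of `DVRSetting.Conclusion`.

## References

* [Howard2004HeegnerKolyvagin] B. Howard, Compositio Math. 140 (2004) 1439–1472, Thm. 1.6.1, proof
  (arXiv:1202.6340 Thm. 2.6.1, p. 12 L40–46).
* [Kaplansky1954] I. Kaplansky, *Infinite Abelian Groups*, Univ. of Michigan Press (1954), §5 Theorems 2, 3, 4
  (PDF pp. 11–14), §12 (PDF p. 40: "Theorems 1–14 hold for modules over principal ideal rings").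
* [Hungerford1974] T. W. Hungerford, *Algebra*, GTM 73, Ch. IV Cor. 6.13, Ch. II §2 Exercise 11 (b).
BSD is not proved by any of this.
-/

namespace Literature.Algebra.Module

open Submodule

universe u v w

variable {R : Type u} [CommRing R]

/-! ### §1 Arithmetic in the cyclic layers `R/(ϖᴺ)` -/

section Cyclic

/-- The `R`-module structure of `R ⧸ I`: `r • (x mod I) = (r x) mod I`. [folklore] -/
private theorem smul_mk_eq_mk_mul (I : Ideal R) (r x : R) :
    r • (Ideal.Quotient.mk I x) = Ideal.Quotient.mk I (r * x) := by
  rw [Algebra.smul_def, Ideal.Quotient.algebraMap_eq, ← map_mul]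

variable [IsDomain R]

/-- In `R/(ϖᴺ)` an element killed by `ϖᵃ` with `a < N` is a multiple of `ϖ` (indeed of `ϖ^{N−a}`).
[cite: Kaplansky1954, §5 (PDF p. 10) with §12 (PDF p. 40)] -/
private theorem exists_eq_smul_of_pow_smul_eq_zero_quotient {ϖ : R} (hϖ0 : ϖ ≠ 0) {a N : ℕ} (haN : a < N)
    {q : R ⧸ Ideal.span {ϖ ^ N}} (hq : ϖ ^ a • q = 0) :
    ∃ q' : R ⧸ Ideal.span {ϖ ^ N}, q = ϖ • q' := by
  obtain ⟨r, rfl⟩ := Ideal.Quotient.mk_surjective q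
  rw [smul_mk_eq_mk_mul, Ideal.Quotient.eq_zero_iff_mem, Ideal.mem_span_singleton] at hq
  obtain ⟨d, hd⟩ := Nat.exists_eq_add_of_lt haN
  -- `ϖ^N = ϖ^a · ϖ^(d+1)` divides `ϖ^a r`, so `ϖ^(d+1) ∣ r`
  rw [hd, add_assoc, pow_add, mul_dvd_mul_iff_left (pow_ne_zero a hϖ0)] at hq
  obtain ⟨s, rfl⟩ := hq
  refine ⟨Ideal.Quotient.mk _ (ϖ ^ d * s), ?_⟩
  rw [smul_mk_eq_mk_mul, ← mul_assoc, ← pow_succ']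

/-- In `R/(ϖᴺ)`, `ϖᶜ · 1 ≠ 0` for `c < N` (`ϖ` a non-unit). [folklore] -/
private theorem pow_smul_one_quotient_ne_zero {ϖ : R} (hϖ0 : ϖ ≠ 0) (hϖu : ¬IsUnit ϖ) {c N : ℕ} (hcN : c < N) :
    ϖ ^ c • (1 : R ⧸ Ideal.span {ϖ ^ N}) ≠ 0 := by
  intro h
  rw [← map_one (Ideal.Quotient.mk _), smul_mk_eq_mk_mul, mul_one, Ideal.Quotient.eq_zero_iff_mem,
    Ideal.mem_span_singleton, pow_dvd_pow_iff hϖ0 hϖu] at h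
  exact absurd h (not_le.2 hcN)

end Cyclic

/-! ### §2 The layers of an internal direct sum split -/

section Layers

variable {A : Type v} [AddCommGroup A] [Module R A]

/-- The layers of an internal direct sum `L = S ⊕ N` split: `L[a] ≅ (S ⊓ L[a]) × (N ⊓ L[a])`. [folklore] -/
private theorem nonempty_torsionBy_linearEquiv_inf_prod_inf {S N : Submodule R A} (h : IsCompl S N) (a : R) :
    Nonempty (↥(torsionBy R A a) ≃ₗ[R] ↥(S ⊓ torsionBy R A a) × ↥(N ⊓ torsionBy R A a)) := by
  classical
  -- the sum map `(s, n) ↦ s + n` into the layer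
  let f : ↥(S ⊓ torsionBy R A a) × ↥(N ⊓ torsionBy R A a) →ₗ[R] ↥(torsionBy R A a) :=
    { toFun := fun sn ↦ ⟨(sn.1 : A) + sn.2, add_mem (mem_inf.1 sn.1.2).2 (mem_inf.1 sn.2.2).2⟩
      map_add' := fun sn sn' ↦ Subtype.ext (by
        simp only [Prod.fst_add, Prod.snd_add, coe_add]
        abel)
      map_smul' := fun r sn ↦ Subtype.ext (by
        simp only [Prod.smul_fst, Prod.smul_snd, coe_smul_of_tower, RingHom.id_apply, smul_add]) }
  refine ⟨(LinearEquiv.ofBijective f ⟨?_, ?_⟩).symm⟩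
  · -- injective: `s + n = 0` with `s ∈ S`, `n ∈ N` forces `s = n = 0`
    rintro ⟨s, n⟩ ⟨s', n'⟩ hst
    have hst' : (s : A) + n = s' + n' := congrArg Subtype.val hst
    have hmem : (s : A) - s' ∈ S ⊓ N := by
      refine mem_inf.2 ⟨sub_mem (mem_inf.1 s.2).1 (mem_inf.1 s'.2).1, ?_⟩
      have : (s : A) - s' = n' - n := by
        rw [sub_eq_sub_iff_add_eq_add, hst']
        exact add_comm _ _
      rw [this]
      exact sub_mem (mem_inf.1 n'.2).1 (mem_inf.1 n.2).1
    rw [h.inf_eq_bot, mem_bot, sub_eq_zero] at hmem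
    have hs : s = s' := Subtype.ext hmem
    subst hs
    have hn : (n : A) = n' := add_left_cancel hst'
    rw [Subtype.ext hn]
  · -- surjective: write `z = s + n`; then `a s = -a n ∈ S ⊓ N = 0`
    rintro ⟨z, hz⟩
    have hz' : z ∈ S ⊔ N := by rw [h.sup_eq_top]; exact mem_top
    obtain ⟨s, hs, n, hn, rfl⟩ := mem_sup.1 hz'
    have haz : a • s + a • n = 0 := by rw [← smul_add]; exact (mem_torsionBy_iff a _).1 hz
    have has : a • s ∈ S ⊓ N := by
      refine mem_inf.2 ⟨S.smul_mem a hs, ?_⟩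
      rw [eq_neg_of_add_eq_zero_left haz]
      exact neg_mem (N.smul_mem a hn)
    rw [h.inf_eq_bot, mem_bot] at has
    have han : a • n = 0 := by rwa [has, zero_add] at haz
    exact ⟨(⟨⟨s, mem_inf.2 ⟨hs, (mem_torsionBy_iff a _).2 has⟩⟩,
      ⟨n, mem_inf.2 ⟨hn, (mem_torsionBy_iff a _).2 han⟩⟩⟩), rfl⟩

end Layers

/-! ### §3 The layers of the span of a tower: `S ⊓ L[ϖⁿ⁺¹] = R ∙ xₙ ≅ R/(ϖⁿ⁺¹)` -/

section TowerLayers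

variable [IsDomain R] [IsDiscreteValuationRing R]
variable {L : Type v} [AddCommGroup L] [Module R L]

/-- **The layers of the span `S` of a tower: `S ⊓ L[ϖⁿ⁺¹] = R ∙ xₙ`.**
[cite: Kaplansky1954, §5 Theorem 4, proof (PDF p. 14) with §12 (PDF p. 40)] -/
theorem span_range_tower_inf_torsionBy_eq {ϖ : R} (hϖ : Irreducible ϖ) {x : ℕ → L} (hx0 : ϖ • x 0 = 0)
    (h00 : x 0 ≠ 0) (hx : ∀ n, ϖ • x (n + 1) = x n) (n : ℕ) :
    span R (Set.range x) ⊓ torsionBy R L (ϖ ^ (n + 1)) = R ∙ x n := by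
  refine le_antisymm (fun y hy ↦ ?_) ?_
  · exact mem_span_singleton_tower_of_pow_smul_eq_zero hϖ h00 hx (mem_inf.1 hy).1
      ((mem_torsionBy_iff _ _).1 (mem_inf.1 hy).2)
  · rw [span_singleton_le_iff_mem, mem_inf, mem_torsionBy_iff]
    exact ⟨subset_span ⟨n, rfl⟩, pow_succ_smul_tower hx0 hx n⟩

/-- The order ideal of `xₙ` is exactly `(ϖⁿ⁺¹)`. [cite: Kaplansky1954, §5 Theorem 4, proof (PDF p. 14)] -/
theorem torsionOf_tower_eq {ϖ : R} (hϖ : Irreducible ϖ) {x : ℕ → L} (hx0 : ϖ • x 0 = 0) (h00 : x 0 ≠ 0)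
    (hx : ∀ n, ϖ • x (n + 1) = x n) (n : ℕ) : Ideal.torsionOf R L (x n) = Ideal.span {ϖ ^ (n + 1)} := by
  refine le_antisymm (fun s hs ↦ ?_) ?_
  · exact Ideal.mem_span_singleton.2 (pow_dvd_of_smul_tower_eq_zero hϖ h00 hx ((Ideal.mem_torsionOf_iff _ _).1 hs))
  · rw [Ideal.span_singleton_le_iff_mem, Ideal.mem_torsionOf_iff]
    exact pow_succ_smul_tower hx0 hx n

/-- **`S ⊓ L[ϖⁿ] ≅ R/(ϖⁿ)` for the span `S` of a tower, every `n`** (for `n = 0` both sides vanish).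
[cite: Kaplansky1954, §5 Theorem 4, proof (PDF p. 14) with §12 (PDF p. 40)] -/
theorem nonempty_span_range_tower_inf_torsionBy_linearEquiv {ϖ : R} (hϖ : Irreducible ϖ) {x : ℕ → L}
    (hx0 : ϖ • x 0 = 0) (h00 : x 0 ≠ 0) (hx : ∀ n, ϖ • x (n + 1) = x n) (n : ℕ) :
    Nonempty (↥(span R (Set.range x) ⊓ torsionBy R L (ϖ ^ n)) ≃ₗ[R] R ⧸ Ideal.span {ϖ ^ n}) := by
  cases n with
  | zero =>
    -- both sides are zero
    haveI : Subsingleton ↥(span R (Set.range x) ⊓ torsionBy R L (ϖ ^ 0)) := by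
      rw [pow_zero, torsionBy_one, inf_bot_eq]
      infer_instance
    haveI : Subsingleton (R ⧸ Ideal.span {ϖ ^ 0}) :=
      Ideal.Quotient.subsingleton_iff.2 (by rw [pow_zero, Ideal.span_singleton_one])
    exact ⟨LinearEquiv.ofSubsingleton _ _⟩
  | succ m =>
    refine ⟨(LinearEquiv.ofEq _ _ (span_range_tower_inf_torsionBy_eq hϖ hx0 h00 hx m)).trans
      (((Ideal.quotTorsionOfEquivSpanSingleton R L (x m)).symm.trans
        (Submodule.quotEquivOfEq _ _ (torsionOf_tower_eq hϖ hx0 h00 hx m))))⟩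

end TowerLayers

/-! ### §4 The main theorem: `ϖ`-primary with layers `R/(ϖ^{e k}) × F k`, `ϖᶜ F k = 0` ⟹ `L ≅ K/R × F k₀` -/

section Main

variable [IsDomain R] [IsDiscreteValuationRing R]
variable {L : Type v} [AddCommGroup L] [Module R L]

/-- **Howard's "and so": a `ϖ`-primary module whose layers `L[ϖ^{e k}]` (`e` unbounded) are
`R/(ϖ^{e k}) ⊕ F_k` with finitely generated `F_k` killed by a fixed `ϖᶜ` is `≅ K/R ⊕ F_{k₀}` for every level
`k₀` with `c ≤ e k₀`.**  ("`H¹_F(K, A)[𝔪^k] ≅ R/𝔪^k ⊕ M^{(k)} ⊕ M^{(k)}` with `len_R(M^{(k)}) < k`, and so for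
some finite `R`-module `M ≅ M^{(k)}` there is an isomorphism `H¹_F(K, A) ≅ 𝒟 ⊕ M ⊕ M`" — here with
`F k` for `M^{(k)} ⊕ M^{(k)}` and `K/R` for `𝒟`.)  Proof: `ϖᶜL` is divisible and non-zero (two layers), so
contains a tower whose span `S ≅ K/R` is a direct summand, `L = S ⊕ N` (Kaplansky §5 Thms. 2, 4); the layers
split, `R/(ϖ^{e k}) × (N ⊓ L[ϖ^{e k}]) ≅ L[ϖ^{e k}] ≅ R/(ϖ^{e k}) × F k`, and cancellation of the finitely
generated common factor (Hungerford IV 6.13) gives `N ⊓ L[ϖ^{e k}] ≅ F k` for every `k`; hence `ϖᶜ N = 0` and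
`N ≅ F k₀`.
[cite: Howard2004HeegnerKolyvagin, Thm. 1.6.1, proof (arXiv Thm. 2.6.1, p. 12 L40–46)]
[cite: Kaplansky1954, §5 Theorems 2 and 4 (PDF pp. 11–14) with §12 (PDF p. 40)]
[cite: Hungerford1974, Ch. IV Cor. 6.13 and Ch. II §2 Exercise 11 (b)] -/
theorem nonempty_linearEquiv_fractionRingQuotient_prod_of_torsionBy_layers {ϖ : R} (hϖ : Irreducible ϖ)
    (hprim : ∀ y : L, ∃ n : ℕ, ϖ ^ n • y = 0) {e : ℕ → ℕ} (he : ∀ m : ℕ, ∃ k, m ≤ e k)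
    {F : ℕ → Type w} [∀ k, AddCommGroup (F k)] [∀ k, Module R (F k)] [∀ k, Module.Finite R (F k)]
    (c : ℕ) (hF : ∀ k (y : F k), ϖ ^ c • y = 0)
    (θ : ∀ k, ↥(torsionBy R L (ϖ ^ e k)) ≃ₗ[R] (R ⧸ Ideal.span {ϖ ^ e k}) × F k)
    (k₀ : ℕ) (hk₀ : c ≤ e k₀) :
    Nonempty (L ≃ₗ[R] (FractionRing R ⧸ (1 : Submodule R (FractionRing R))) × F k₀) := by
  classical
  have hϖ0 : ϖ ≠ 0 := hϖ.ne_zero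
  have hϖu : ¬IsUnit ϖ := hϖ.not_isUnit
  have T_mono : ∀ {m n : ℕ}, m ≤ n → torsionBy R L (ϖ ^ m) ≤ torsionBy R L (ϖ ^ n) :=
    fun h ↦ torsionBy_le_torsionBy_of_dvd _ _ (pow_dvd_pow ϖ h)
  -- Step 1: `P = ϖᶜ L` is `ϖ`-divisible (read through two layers `e k < e k'`) and non-zero.
  let P : Submodule R L := LinearMap.range (LinearMap.lsmul R L (ϖ ^ c))
  have memP : ∀ {y : L}, y ∈ P ↔ ∃ z : L, ϖ ^ c • z = y := fun {y} ↦ by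
    simp only [P, LinearMap.mem_range, LinearMap.lsmul_apply]
  have hPdivϖ : ∀ y ∈ P, ∃ y' ∈ P, ϖ • y' = y := by
    intro y hy
    obtain ⟨z, rfl⟩ := memP.1 hy
    obtain ⟨n, hn⟩ := hprim z
    obtain ⟨k, hk⟩ := he n
    obtain ⟨k', hk'⟩ := he (e k + 1)
    have hzn : z ∈ torsionBy R L (ϖ ^ n) := (mem_torsionBy_iff _ _).2 hn
    have hzT : z ∈ torsionBy R L (ϖ ^ e k') := T_mono (by omega) hzn
    -- `ϖ^{e k}` kills `z`, hence the first coordinate `q` of `θ k' z`, so `q = ϖ q'`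
    have hkill : ϖ ^ e k • (⟨z, hzT⟩ : ↥(torsionBy R L (ϖ ^ e k'))) = 0 :=
      Subtype.ext ((mem_torsionBy_iff _ _).1 (T_mono hk hzn))
    have hq0 : ϖ ^ e k • (θ k' ⟨z, hzT⟩).1 = 0 := by
      rw [← Prod.smul_fst, ← map_smul, hkill, map_zero, Prod.fst_zero]
    obtain ⟨q', hq'⟩ := exists_eq_smul_of_pow_smul_eq_zero_quotient hϖ0 (by omega : e k < e k') hq0
    -- `ϖᶜ z = ϖᶜ⁺¹ w` with `w = θ⁻¹ (q', 0)`
    have key : ϖ ^ c • (⟨z, hzT⟩ : ↥(torsionBy R L (ϖ ^ e k'))) = ϖ ^ (c + 1) • (θ k').symm (q', 0) := by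
      apply (θ k').injective
      rw [map_smul, map_smul, LinearEquiv.apply_symm_apply, Prod.ext_iff]
      refine ⟨?_, ?_⟩
      · rw [Prod.smul_fst, Prod.smul_fst, hq', ← mul_smul, ← pow_succ]
      · rw [Prod.smul_snd, Prod.smul_snd, hF, smul_zero]
    refine ⟨ϖ ^ c • ((θ k').symm (q', 0) : L), memP.2 ⟨_, rfl⟩, ?_⟩
    have key' := congrArg Subtype.val key
    simp only [SetLike.val_smul] at key'
    rw [key', pow_succ', mul_smul]
  have hPne : P ≠ ⊥ := by
    obtain ⟨k, hk⟩ := he (c + 1)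
    intro hP
    have hg : ϖ ^ c • (((θ k).symm (1, 0) : ↥(torsionBy R L (ϖ ^ e k))) : L) = 0 :=
      (Submodule.eq_bot_iff P).1 hP _ (memP.2 ⟨_, rfl⟩)
    have h1 : ϖ ^ c • (θ k).symm (1, 0) = 0 := Subtype.ext (by simpa using hg)
    have h2 := congrArg (θ k) h1
    rw [map_smul, LinearEquiv.apply_symm_apply, map_zero, Prod.smul_mk, smul_zero, Prod.mk_eq_zero] at h2
    exact pow_smul_one_quotient_ne_zero hϖ0 hϖu (by omega : c < e k) h2.1
  -- Step 2: a tower in `P`, its span `S ≅ K/R` and a complement `N`.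
  have hPdiv : ∀ r : R, r ≠ 0 → ∀ y ∈ P, ∃ y' ∈ P, r • y' = y :=
    Purity.divisible_of_forall_exists_smul_eq hϖ hPdivϖ
  obtain ⟨x, -, hx0, hx00, hx⟩ := exists_tower_mem_of_divisible hϖ0 hprim hPdiv hPne
  obtain ⟨N, hSN⟩ := exists_isCompl_of_divisible (divisible_span_range_tower hϖ hx)
  obtain ⟨eS⟩ := nonempty_linearEquiv_fractionRing_quotient_of_tower hϖ hx0 hx00 hx
  -- Step 3: every layer of `N` is `F k` (splitting + cancellation of `R/(ϖ^{e k})`).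
  have layerN : ∀ k, Nonempty (↥(N ⊓ torsionBy R L (ϖ ^ e k)) ≃ₗ[R] F k) := by
    intro k
    obtain ⟨τ⟩ := nonempty_torsionBy_linearEquiv_inf_prod_inf hSN (ϖ ^ e k)
    obtain ⟨σ⟩ := nonempty_span_range_tower_inf_torsionBy_linearEquiv hϖ hx0 hx00 hx (e k)
    haveI : Module.Finite R ↥(torsionBy R L (ϖ ^ e k)) := Module.Finite.equiv (θ k).symm
    haveI : Module.Finite R ↥(N ⊓ torsionBy R L (ϖ ^ e k)) :=
      Module.Finite.of_injective (Submodule.inclusion inf_le_right) (Submodule.inclusion_injective _)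
    -- `(N ⊓ L[ϖ^{e k}]) × R/(ϖ^{e k}) ≅ F k × R/(ϖ^{e k})`
    exact nonempty_linearEquiv_of_prod_linearEquiv_prod
      ((((LinearEquiv.prodComm R _ _).trans ((σ.symm.prodCongr (LinearEquiv.refl R _)).trans τ.symm)).trans
        (θ k)).trans (LinearEquiv.prodComm R _ _))
  -- Step 4: `ϖᶜ N = 0`, so `N = N ⊓ L[ϖ^{e k₀}] ≅ F k₀`.
  have hNc : ∀ y ∈ N, ϖ ^ c • y = 0 := by
    intro y hyN
    obtain ⟨n, hn⟩ := hprim y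
    obtain ⟨k, hk⟩ := he n
    have hyT : y ∈ torsionBy R L (ϖ ^ e k) := T_mono hk ((mem_torsionBy_iff _ _).2 hn)
    obtain ⟨ψ⟩ := layerN k
    have h := hF k (ψ ⟨y, mem_inf.2 ⟨hyN, hyT⟩⟩)
    rw [← map_smul, ψ.map_eq_zero_iff] at h
    simpa using congrArg Subtype.val h
  have hNeq : N ⊓ torsionBy R L (ϖ ^ e k₀) = N :=
    inf_eq_left.2 fun y hy ↦ T_mono hk₀ ((mem_torsionBy_iff _ _).2 (hNc y hy))
  obtain ⟨ψ₀⟩ := layerN k₀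
  exact ⟨(prodEquivOfIsCompl _ N hSN).symm.trans
    (eS.prodCongr ((LinearEquiv.ofEq _ _ hNeq.symm).trans ψ₀))⟩

/-! ### §5 The exhaustion form and Howard's currency -/

/-- **Exhaustion form**: if `L` is the union of the ranges of injections `ι k : G k ↪ L` with
`range (ι k) = L[ϖ^{e k}]` (`e` unbounded) and `G k ≅ R/(ϖ^{e k}) × F k` with finitely generated `F k` killed by
a fixed `ϖᶜ`, then `L ≅ K/R × F k₀` for every `k₀` with `c ≤ e k₀` — the shape in which Howard's
`H¹_F(K, T^{(k)}) ↪ H¹_F(K, A)`, `H¹_F(K, T^{(k)}) ≅ H¹_F(K, A)[𝔪^{e_k}]` (Lemma 1.3.3) and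
`H¹_F(K, T^{(k)}) ≅ R/𝔪^{e_k} ⊕ M^{(k)} ⊕ M^{(k)}` (Thm. 1.4.2 / Prop. 1.5.5) arrive.
[cite: Howard2004HeegnerKolyvagin, Thm. 1.6.1, proof (arXiv Thm. 2.6.1, p. 12 L40–46)]
[cite: Kaplansky1954, §5 Theorems 2 and 4 (PDF pp. 11–14) with §12 (PDF p. 40)] -/
theorem nonempty_linearEquiv_fractionRingQuotient_prod_of_layers {ϖ : R} (hϖ : Irreducible ϖ)
    {e : ℕ → ℕ} (he : ∀ m : ℕ, ∃ k, m ≤ e k)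
    {G : ℕ → Type w} [∀ k, AddCommGroup (G k)] [∀ k, Module R (G k)]
    (ι : ∀ k, G k →ₗ[R] L) (hι : ∀ k, Function.Injective (ι k))
    (hrange : ∀ k, LinearMap.range (ι k) = torsionBy R L (ϖ ^ e k)) (hL : ∀ y : L, ∃ k, y ∈ LinearMap.range (ι k))
    {F : ℕ → Type w} [∀ k, AddCommGroup (F k)] [∀ k, Module R (F k)] [∀ k, Module.Finite R (F k)]
    (c : ℕ) (hF : ∀ k (y : F k), ϖ ^ c • y = 0)
    (θ : ∀ k, G k ≃ₗ[R] (R ⧸ Ideal.span {ϖ ^ e k}) × F k) (k₀ : ℕ) (hk₀ : c ≤ e k₀) :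
    Nonempty (L ≃ₗ[R] (FractionRing R ⧸ (1 : Submodule R (FractionRing R))) × F k₀) := by
  have hprim : ∀ y : L, ∃ n : ℕ, ϖ ^ n • y = 0 := fun y ↦ by
    obtain ⟨k, hk⟩ := hL y
    rw [hrange] at hk
    exact ⟨e k, (mem_torsionBy_iff _ _).1 hk⟩
  refine nonempty_linearEquiv_fractionRingQuotient_prod_of_torsionBy_layers hϖ hprim he c hF
    (fun k ↦ (((LinearEquiv.ofInjective (ι k) (hι k)).trans
      (LinearEquiv.ofEq _ _ (hrange k))).symm.trans (θ k))) k₀ hk₀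

/-- **Howard's currency** (`DVRSetting.Conclusion` (ii)): over a discrete valuation ring with
`𝔪 = maximalIdeal R = (ϖ)`, a `ϖ`-primary module whose layers `L[ϖ^{e k}]` are
`R/𝔪^{e k} ⊕ M_k ⊕ M_k` with finitely generated `M_k` killed by a fixed `ϖᶜ` is `≅ K/R ⊕ M_{k₀} ⊕ M_{k₀}`
for every `k₀` with `c ≤ e k₀` ("for some finite `R`-module `M ≅ M^{(k)}` there is an isomorphism
`H¹_F(K, A) ≅ 𝒟 ⊕ M ⊕ M`").
[cite: Howard2004HeegnerKolyvagin, Thm. 1.6.1, proof (arXiv Thm. 2.6.1, p. 12 L40–46)]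
[cite: Kaplansky1954, §5 Theorems 2 and 4 (PDF pp. 11–14) with §12 (PDF p. 40)] -/
theorem nonempty_linearEquiv_fractionRingQuotient_prod_prod_of_torsionBy_layers {ϖ : R} (hϖ : Irreducible ϖ)
    (hunif : IsLocalRing.maximalIdeal R = Ideal.span {ϖ})
    (hprim : ∀ y : L, ∃ n : ℕ, ϖ ^ n • y = 0) {e : ℕ → ℕ} (he : ∀ m : ℕ, ∃ k, m ≤ e k)
    {M : ℕ → Type w} [∀ k, AddCommGroup (M k)] [∀ k, Module R (M k)] [∀ k, Module.Finite R (M k)]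
    (c : ℕ) (hM : ∀ k (y : M k), ϖ ^ c • y = 0)
    (θ : ∀ k, ↥(torsionBy R L (ϖ ^ e k)) ≃ₗ[R] (R ⧸ IsLocalRing.maximalIdeal R ^ e k) × (M k × M k))
    (k₀ : ℕ) (hk₀ : c ≤ e k₀) :
    Nonempty (L ≃ₗ[R] (FractionRing R ⧸ (1 : Submodule R (FractionRing R))) × (M k₀ × M k₀)) := by
  have hpow : ∀ n : ℕ, IsLocalRing.maximalIdeal R ^ n = Ideal.span {ϖ ^ n} := fun n ↦ by
    rw [hunif, Ideal.span_singleton_pow]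
  exact nonempty_linearEquiv_fractionRingQuotient_prod_of_torsionBy_layers hϖ hprim he (F := fun k ↦ M k × M k)
    c (fun k y ↦ by rw [Prod.smul_mk, hM, hM, Prod.mk_zero_zero])
    (fun k ↦ (θ k).trans ((Submodule.quotEquivOfEq _ _ (hpow (e k))).prodCongr (LinearEquiv.refl R _))) k₀ hk₀

end Main

end Literature.Algebra.Module
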